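import Summits.AnomalousDissipation.AnomalousDissipation.Theorems.SolenoidalFractalHomogenisationLagrangianCarrierConstructionTowerStep
import Summits.AnomalousDissipation.AnomalousDissipation.Theorems.SolenoidalFractalHomogenisationLagrangianCarrierConstructionLevelField
import Literature.Analysis.FluidPDE.LagrangianLatticeCarrier
import HarnessLib

/-!
# K3L `LagrangianCarrierConstruction` (stmt-AnomalousDissipation-24913), line `birth`: the Lagrangian insertion exists —
# `IsLagrangian` over every carrier datum (helper; `--supports stmt-AnomalousDissipation-24913`)

Summits-side helper file (everything proved; no definitions, no named facts). `exists_isLagrangian` is, verbatim, the statement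
of the stub `stub_flowsL` of the planner's skeleton r21 (sha16 ad9036e1528bcc84) of `Cruxes.LagrangianCarrierConstruction.Birth`;
the skeleton was re-registered meanwhile (r22 v4, sha16 fedb8f2dd8674275) with a stronger `stub_flowsL` (extra hypotheses
`Permissible`, (W1), (W2) and the extra conclusion `E'.LevelRegular`), of which this theorem is the `IsLagrangian` half:
for EVERY Lagrangian lattice carrier datum `E` there are level fields `b` and Lagrangian displacements `disp` over the same
bookkeeping (`FractalCarrierData`, refresh windows, strain budgets) such that `E'.IsLagrangian`: every `disp m` IS the flow of
`b 1 + ⋯ + b m` in integral form (`IsFlow`) and every `b (m+1)` IS the Eulerian lattice level `level (m+1)` pushed forward by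
that flow from the left end of each refresh window (`IsInserted`) — Armstrong–Vicol's Lagrangian insertion
(arXiv:2305.05048 §2.2) for lattice shear words.

Construction (the LAGRANGIAN TOWER, lifted to `ℝ³`): starting from `A₀ = id`, `B₀ = 0`, iterate `…TowerStep.tower_step`
with the lifted Eulerian level field `v_{m+1}(t, z) = level (m+1) t (proj z)` (admissible by `…LevelField`) and the window
length `refresh (m+1)`: `A_{m+1} t = A_m t ∘ A_m(w)⁻¹ ∘ φ_{m+1}(t, w) ∘ C_{m+1} ⌊t/refresh⌋`, with velocity
`B_{m+1} = B_m + D X_m(t,w) ∘ X_m(w,t) · v_{m+1} ∘ X_m(w,t)`, `X_m(t,s) = A_m t ∘ (A_m s)⁻¹`, `w = ⌊t/refresh⌋·refresh`. Descent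
to the torus: `disp m t s x := X_m(t,s)(repr x) − repr x`, `b (m+1) t x := (B_{m+1} − B_m)(t, repr x)`; lattice equivariance
makes `X m t s = proj ∘ X_m(t,s) ∘ repr` and `flowDeriv m t s = D X_m(t,s) ∘ repr`, so `IsInserted` holds by construction, and
`IsFlow` is the integral form of the flow equation `∂ₜ A_m t = B_m t ∘ A_m t` off the countable break times (fundamental theorem
of calculus off a countable set, `…TowerCalculus`). This is the construction side of route-1's rung leaf F-D1.A0 (a frontier
FORMAL rung); it is NOT a proof of anomalous dissipation, of Onsager's conjecture, or of the crux by itself.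
-/

set_option linter.dupNamespace false

noncomputable section

namespace Summit.AnomalousDissipation.AnomalousDissipation.Theorems.SolenoidalFractalHomogenisation.LagrangianCarrierConstruction

open Set Function Filter Topology Metric MeasureTheory
open scoped NNReal
open Literature.Analysis Literature.Analysis.ODE Literature.Analysis.FunctionSpaces Literature.Analysis.FunctionSpaces.Torus
open Literature.Analysis.FluidPDE Literature.Analysis.FluidPDE.LatticeShear

section Descent

variable {d : Type*} [Fintype d] [DecidableEq d]

/-- The lift of the displacement `x ↦ F (repr x) − repr x` of a lattice-equivariant map `F` is `F − id`. [folklore] -/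
theorem lift_disp_eq {F : EuclideanSpace ℝ d → EuclideanSpace ℝ d}
    (hF : ∀ z (k : d → ℤ), F (z + latticeVec k) = F z + latticeVec k) (z : EuclideanSpace ℝ d) :
    Torus.lift (fun x : UnitAddTorus d => F (repr x) - repr x) z = F z - z := by
  rw [Torus.lift_apply]
  obtain ⟨k, hk⟩ := exists_repr_proj_eq_add_latticeVec_holds z
  rw [hk, hF]
  abel

omit [Fintype d] [DecidableEq d] in
/-- The torus map `x ↦ x + proj (F (repr x) − repr x)` of a displacement is `proj ∘ F ∘ repr`. [folklore] -/
theorem add_proj_disp_eq (F : EuclideanSpace ℝ d → EuclideanSpace ℝ d) (x : UnitAddTorus d) :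
    x + proj (F (repr x) - repr x) = proj (F (repr x)) := by
  have h : proj (F (repr x) - repr x) = proj (F (repr x)) - proj (repr x) := by
    rw [sub_eq_add_neg, Torus.proj_add, Torus.proj_neg, ← sub_eq_add_neg]
  rw [h, proj_repr]
  abel

/-- A periodic function read through `repr ∘ proj` is itself. [folklore] -/
theorem periodic_repr_proj {F : Type*} {g : EuclideanSpace ℝ d → F} (hg : ∀ z (k : d → ℤ), g (z + latticeVec k) = g z)
    (z : EuclideanSpace ℝ d) : g (repr (proj z)) = g z := by
  obtain ⟨k, hk⟩ := exists_repr_proj_eq_add_latticeVec_holds z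
  rw [hk, hg]

end Descent

section Slabs

/-- One-sided joint `C¹` slabs at every time give continuity of each trajectory `t ↦ A t z`. [folklore] -/
theorem continuous_apply_of_slabs {V : Type*} [NormedAddCommGroup V] [NormedSpace ℝ V] (A : ℝ → V ≃ V)
    (h3 : ∀ r, ∃ ε > 0, ContDiffOn ℝ 1 (fun p : ℝ × V => A p.1 p.2) (Icc r (r + ε) ×ˢ univ) ∧
      ContDiffOn ℝ 1 (fun p : ℝ × V => A p.1 p.2) (Icc (r - ε) r ×ˢ univ)) (z : V) :
    Continuous fun t => A t z := by
  refine continuous_iff_continuousAt.2 fun r => ?_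
  obtain ⟨ε, hε, hR, hL⟩ := h3 r
  have hcR : ContinuousWithinAt (fun t => A t z) (Icc r (r + ε)) r :=
    (hR.continuousOn.comp (continuous_id.prodMk continuous_const).continuousOn
      (fun t ht => ⟨ht, mem_univ _⟩)) r ⟨le_rfl, by linarith⟩
  have hcL : ContinuousWithinAt (fun t => A t z) (Icc (r - ε) r) r :=
    (hL.continuousOn.comp (continuous_id.prodMk continuous_const).continuousOn
      (fun t ht => ⟨ht, mem_univ _⟩)) r ⟨by linarith, le_rfl⟩
  rw [continuousWithinAt_Icc_iff_Ici (by linarith)] at hcR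
  rw [continuousWithinAt_Icc_iff_Iic (by linarith)] at hcL
  exact continuousAt_iff_continuous_left_right.2 ⟨hcL, hcR⟩

end Slabs

/-- **The Lagrangian insertion exists over every carrier datum** (the r21 form of `stub_flowsL`): over ANY Lagrangian
lattice carrier datum there are level fields and Lagrangian displacements with the same bookkeeping, refresh windows and strain
budgets which satisfy `IsLagrangian` (every displacement is the flow of the partial sum of the level fields, in integral form, and every
level is the Eulerian lattice level pushed forward by the coarser flow from each refresh window's left end). Witness: the
Lagrangian tower of the module docstring. [cite: ArmstrongVicol2025, §2.2 (PDF pp. 12, 18: b_m = b_{m−1} + Σ_l 𝟙 v_m(t, X_{m−1}^{-1}(t,x,lτ″_m)); the flows X_m)] -/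
theorem exists_isLagrangian : ∀ k (E : Literature.Analysis.FluidPDE.LatticeShear.LagrangianLatticeCarrier k), ∃ E' : Literature.Analysis.FluidPDE.LatticeShear.LagrangianLatticeCarrier k, E'.toFractalCarrierData = E.toFractalCarrierData ∧ E'.refresh = E.refresh ∧ E'.θ = E.θ ∧ E'.IsLagrangian := by
  intro k E
  -- the lifted Eulerian level fields and their admissibility
  obtain ⟨v, hv⟩ : ∃ v : ℕ → ℝ → EuclideanSpace ℝ (Fin 3) → EuclideanSpace ℝ (Fin 3),
      ∀ m t z, v m t z = E.toFractalCarrierData.level m t (proj z) := ⟨_, fun _ _ _ => rfl⟩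
  have hvU : ∀ m, IsUniformlyLipschitzOn (v m) univ := fun m => by
    have e : v m = fun t z => E.toFractalCarrierData.level m t (proj z) := funext fun t => funext fun z => hv m t z
    rw [e]; exact isUniformlyLipschitzOn_level_proj _ m
  have hvper : ∀ m t z (n : Fin 3 → ℤ), v m t (z + latticeVec n) = v m t z := fun m t z n => by
    rw [hv, hv, level_proj_add_latticeVec]
  have hvloc : ∀ m r, ∃ ε > 0, ContDiffOn ℝ 1 (uncurry (v m)) (Icc r (r + ε) ×ˢ univ) ∧
      ContDiffOn ℝ 1 (uncurry (v m)) (Icc (r - ε) r ×ˢ univ) := fun m r => by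
    have e : v m = fun t z => E.toFractalCarrierData.level m t (proj z) := funext fun t => funext fun z => hv m t z
    rw [e]; exact exists_contDiffOn_slabs_level_proj _ m r
  have hvbdd : ∀ m, ∃ C : ℝ, ∀ t z, ‖v m t z‖ ≤ C := fun m =>
    ⟨_, fun t z => by rw [hv]; exact norm_level_proj_le _ m t z⟩
  -- the tower invariant
  let INV : (ℝ → EuclideanSpace ℝ (Fin 3) ≃ EuclideanSpace ℝ (Fin 3)) → (ℝ → EuclideanSpace ℝ (Fin 3) → EuclideanSpace ℝ (Fin 3)) →
      Set ℝ → Prop := fun A B D =>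
    (∀ t z (n : Fin 3 → ℤ), A t (z + latticeVec n) = A t z + latticeVec n) ∧
    (∀ r, ∃ ε > 0, ContDiffOn ℝ 1 (fun p : ℝ × EuclideanSpace ℝ (Fin 3) => A p.1 p.2) (Icc r (r + ε) ×ˢ univ) ∧
      ContDiffOn ℝ 1 (fun p : ℝ × EuclideanSpace ℝ (Fin 3) => A p.1 p.2) (Icc (r - ε) r ×ˢ univ)) ∧
    (∀ r, ∃ ε > 0, ContDiffOn ℝ 1 (fun p : ℝ × EuclideanSpace ℝ (Fin 3) => (A p.1).symm p.2) (Icc r (r + ε) ×ˢ univ) ∧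
      ContDiffOn ℝ 1 (fun p : ℝ × EuclideanSpace ℝ (Fin 3) => (A p.1).symm p.2) (Icc (r - ε) r ×ˢ univ)) ∧
    D.Countable ∧
    (∀ t ∉ D, ∃ ε > 0, ContDiffOn ℝ 1 (fun p : ℝ × EuclideanSpace ℝ (Fin 3) => A p.1 p.2) (Icc (t - ε) (t + ε) ×ˢ univ)) ∧
    (∀ t ∉ D, ∃ ε > 0, ContDiffOn ℝ 1 (fun p : ℝ × EuclideanSpace ℝ (Fin 3) => (A p.1).symm p.2)
      (Icc (t - ε) (t + ε) ×ˢ univ)) ∧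
    (∀ t ∉ D, ∀ z, HasDerivAt (fun τ => A τ z) (B t (A t z)) t) ∧
    (∀ t z (n : Fin 3 → ℤ), B t (z + latticeVec n) = B t z) ∧
    (∀ a b : ℝ, ∃ C : ℝ, ∀ t ∈ Icc a b, ∀ z, ‖B t z‖ ≤ C) ∧
    (∀ t ∉ D, ∀ z, ContinuousAt (uncurry B) (t, z)) ∧
    (∀ a b : ℝ, ∃ K : ℝ, ∀ t ∈ Icc a b, ∀ z, ‖fderiv ℝ (A t) z‖ ≤ K) ∧
    (∀ a b : ℝ, ∃ K : ℝ, ∀ t ∈ Icc a b, ∀ z, ‖fderiv ℝ (fun y => (A t).symm y) z‖ ≤ K)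
  -- the inserted velocity of level `m+1` over a coarse flow `A`
  let INS : ℕ → (ℝ → EuclideanSpace ℝ (Fin 3) ≃ EuclideanSpace ℝ (Fin 3)) → ℝ → EuclideanSpace ℝ (Fin 3) →
      EuclideanSpace ℝ (Fin 3) := fun m A t z =>
    fderiv ℝ (fun y => A t ((A ((⌊t / E.refresh (m + 1)⌋ : ℝ) * E.refresh (m + 1))).symm y))
      (A ((⌊t / E.refresh (m + 1)⌋ : ℝ) * E.refresh (m + 1)) ((A t).symm z))
      (v (m + 1) t (A ((⌊t / E.refresh (m + 1)⌋ : ℝ) * E.refresh (m + 1)) ((A t).symm z)))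
  have base : INV (fun _ => Equiv.refl _) (fun _ _ => 0) ∅ := by
    refine ⟨fun t z n => rfl, fun r => ⟨1, one_pos, contDiff_snd.contDiffOn, contDiff_snd.contDiffOn⟩,
      fun r => ⟨1, one_pos, contDiff_snd.contDiffOn, contDiff_snd.contDiffOn⟩, countable_empty,
      fun t _ => ⟨1, one_pos, contDiff_snd.contDiffOn⟩, fun t _ => ⟨1, one_pos, contDiff_snd.contDiffOn⟩,
      fun t _ z => by simpa using hasDerivAt_const t z, fun t z n => rfl, fun a b => ⟨0, fun t _ z => by simp⟩,
      fun t _ z => continuous_const.continuousAt, fun a b => ⟨1, fun t _ z => ?_⟩, fun a b => ⟨1, fun t _ z => ?_⟩⟩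
    · simp only [Equiv.coe_refl, fderiv_id]; exact ContinuousLinearMap.norm_id_le
    · simp only [Equiv.refl_symm, Equiv.coe_refl]
      rw [show (fun y : EuclideanSpace ℝ (Fin 3) => id y) = id from rfl, fderiv_id]; exact ContinuousLinearMap.norm_id_le
  have step : ∀ m A B D, INV A B D → ∃ A' D', INV A' (fun t z => B t z + INS m A t z) D' := by
    intro m A B D h
    obtain ⟨i1, i3, i3', i4, i4a, i4b, i5, i7a, i7b, i7c, i8, i8'⟩ := h
    exact tower_step A B D i1 i3 i3' i4 i4a i4b i5 i7a i7b i7c i8 i8' (v (m + 1)) (hvU _) (hvper _) (hvloc _) (hvbdd _)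
      (E.refresh (m + 1)) (E.refresh_pos _)
  -- the tower
  obtain ⟨A, Bs, Ds, hB0, hBsucc, hINV⟩ : ∃ (A : ℕ → ℝ → EuclideanSpace ℝ (Fin 3) ≃ EuclideanSpace ℝ (Fin 3))
      (Bs : ℕ → ℝ → EuclideanSpace ℝ (Fin 3) → EuclideanSpace ℝ (Fin 3)) (Ds : ℕ → Set ℝ),
      Bs 0 = (fun _ _ => 0) ∧ (∀ m, Bs (m + 1) = fun t z => Bs m t z + INS m (A m) t z) ∧ ∀ m, INV (A m) (Bs m) (Ds m) := by
    let T : ℕ → {p : (ℝ → EuclideanSpace ℝ (Fin 3) ≃ EuclideanSpace ℝ (Fin 3)) ×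
        (ℝ → EuclideanSpace ℝ (Fin 3) → EuclideanSpace ℝ (Fin 3)) × Set ℝ // INV p.1 p.2.1 p.2.2} :=
      fun m => Nat.rec ⟨(fun _ => Equiv.refl _, fun _ _ => 0, ∅), base⟩
        (fun m T => ⟨((step m T.1.1 T.1.2.1 T.1.2.2 T.2).choose, fun t z => T.1.2.1 t z + INS m T.1.1 t z,
          (step m T.1.1 T.1.2.1 T.1.2.2 T.2).choose_spec.choose), (step m T.1.1 T.1.2.1 T.1.2.2 T.2).choose_spec.choose_spec⟩) m
    exact ⟨fun m => (T m).1.1, fun m => (T m).1.2.1, fun m => (T m).1.2.2, rfl, fun m => rfl, fun m => (T m).2⟩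
  -- the level fields and displacements on the torus
  obtain ⟨bf, hb0, hbS⟩ : ∃ bf : ℕ → ℝ → UnitAddTorus (Fin 3) → EuclideanSpace ℝ (Fin 3),
      (∀ t x, bf 0 t x = 0) ∧ ∀ m t x, bf (m + 1) t x = INS m (A m) t (repr x) :=
    ⟨fun m t x => match m with | 0 => 0 | m + 1 => INS m (A m) t (repr x), fun _ _ => rfl, fun _ _ _ => rfl⟩
  obtain ⟨dsp, hdsp⟩ : ∃ dsp : ℕ → ℝ → ℝ → UnitAddTorus (Fin 3) → EuclideanSpace ℝ (Fin 3),
      ∀ m t s x, dsp m t s x = A m t ((A m s).symm (repr x)) - repr x := ⟨_, fun _ _ _ _ => rfl⟩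
  -- the partial sums of the level fields are the tower velocities
  have hsum : ∀ m t z, ∑ i ∈ Finset.range m, bf (i + 1) t (proj z) = Bs m t z := by
    intro m
    induction m with
    | zero => intro t z; simp [hB0]
    | succ n ih =>
      intro t z
      rw [Finset.sum_range_succ, ih, hBsucc, hbS]
      -- periodicity of the inserted velocity through `repr ∘ proj`
      have hper : ∀ y (k' : Fin 3 → ℤ), INS n (A n) t (y + latticeVec k') = INS n (A n) t y := fun y k' =>
        inserted_add_latticeVec (A n) (v (n + 1)) t _ (hINV n).1 (hvper _) y k'
      simp only []
      rw [periodic_repr_proj hper]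
  refine ⟨⟨E.toFractalCarrierData, E.refresh, E.θ, bf, dsp, E.refresh_pos, E.θ_pos⟩, rfl, rfl, rfl, fun m => ⟨?_, ?_⟩⟩
  · -- `IsFlow m`: the integral form of the flow equation of `A m`
    intro t s x
    obtain ⟨i1, i3, -, i4, -, -, i5, i7a, i7b, i7c, -, -⟩ := hINV m
    set z₀ : EuclideanSpace ℝ (Fin 3) := (A m s).symm (repr x) with hz₀
    show dsp m t s x = ∫ r in s..t, ∑ i ∈ Finset.range m, bf (i + 1) r (x + proj (dsp m r s x))
    have hX : ∀ r, x + proj (dsp m r s x) = proj (A m r z₀) := fun r => by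
      rw [hdsp]; exact add_proj_disp_eq (fun y => A m r ((A m s).symm y)) x
    simp only [hX, hsum]
    have hcontA : Continuous fun r => A m r z₀ := continuous_apply_of_slabs (A m) i3 z₀
    have hcont : Continuous fun r => A m r z₀ - repr x := hcontA.sub continuous_const
    have hderiv : ∀ r ∉ Ds m, HasDerivAt (fun r => A m r z₀ - repr x) (Bs m r (A m r z₀)) r :=
      fun r hr => (i5 r hr z₀).sub_const _
    have hint : ∀ a b : ℝ, IntervalIntegrable (fun r => Bs m r (A m r z₀)) volume a b := by
      refine intervalIntegrable_of_bounded_of_continuousAt_off_countable i4 (fun r hr => ?_) (fun a b => ?_)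
      · exact ContinuousAt.comp_of_eq (i7c r hr (A m r z₀)) (continuous_id.prodMk hcontA).continuousAt rfl
      · obtain ⟨C, hC⟩ := i7b a b
        exact ⟨C, fun r hr => hC r hr _⟩
    rw [integral_eq_sub_of_hasDerivAt_off_countable i4 hcont hderiv hint s t, hdsp]
    have hFs : A m s z₀ = repr x := by rw [hz₀]; exact Equiv.apply_symm_apply _ _
    rw [hFs, sub_self, sub_zero]
  · -- `IsInserted m`: the level `m+1` field is the pushed-forward Eulerian level, window by window
    intro j t ht y
    obtain ⟨i1, i3, i3', -, -, -, -, -, -, -, -, -⟩ := hINV m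
    have hAc : ∀ τ, ContDiff ℝ 1 (A m τ) ∧ ContDiff ℝ 1 (A m τ).symm := fun τ => by
      obtain ⟨ε, hε, hR1, -⟩ := i3 τ
      obtain ⟨ε', hε', hR2, -⟩ := i3' τ
      exact ⟨contDiff_slice_of_slab (Φ := fun p : ℝ × EuclideanSpace ℝ (Fin 3) => A m p.1 p.2) (S := Icc τ (τ + ε))
          ⟨le_rfl, by linarith⟩ hR1,
        contDiff_slice_of_slab (Φ := fun p : ℝ × EuclideanSpace ℝ (Fin 3) => (A m p.1).symm p.2) (S := Icc τ (τ + ε'))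
          ⟨le_rfl, by linarith⟩ hR2⟩
    set s : ℝ := (j : ℝ) * E.refresh (m + 1) with hs
    -- the frame: equivariance and smoothness of `X(t, s) = A t ∘ (A s)⁻¹`
    have hXeq : ∀ z (k' : Fin 3 → ℤ), A m t ((A m s).symm (z + latticeVec k')) = A m t ((A m s).symm z) + latticeVec k' :=
      fun z k' => by rw [equivariant_symm (i1 s), i1]
    have hXd : Differentiable ℝ fun z => A m t ((A m s).symm z) :=
      ((hAc t).1.comp (hAc s).2).differentiable (by simp)
    show bf (m + 1) t (y + proj (dsp m t s y)) =
      (ContinuousLinearMap.id ℝ (EuclideanSpace ℝ (Fin 3)) + fderiv ℝ (Torus.lift (dsp m t s)) (repr y))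
        (E.toFractalCarrierData.level (m + 1) t y)
    -- left-hand side: the inserted velocity at the pushed point
    have hX : y + proj (dsp m t s y) = proj (A m t ((A m s).symm (repr y))) := by
      rw [hdsp]; exact add_proj_disp_eq (fun y' => A m t ((A m s).symm y')) y
    have hper : ∀ z (k' : Fin 3 → ℤ), INS m (A m) t (z + latticeVec k') = INS m (A m) t z := fun z k' =>
      inserted_add_latticeVec (A m) (v (m + 1)) t _ i1 (hvper _) z k'
    have hfl : ⌊t / E.refresh (m + 1)⌋ = j := floor_eq_of_mem_Ico (E.refresh_pos _) ht
    rw [hX, hbS, periodic_repr_proj hper]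
    simp only [INS, hfl, ← hs, Equiv.symm_apply_apply, Equiv.apply_symm_apply, hv, proj_repr]
    -- right-hand side: the derivative of the lifted displacement
    have hl : Torus.lift (dsp m t s) = fun z => A m t ((A m s).symm z) - z := by
      funext z
      have e : dsp m t s = fun x => (fun y' => A m t ((A m s).symm y')) (repr x) - repr x := funext fun x => hdsp m t s x
      rw [e]
      exact lift_disp_eq (F := fun y' => A m t ((A m s).symm y')) hXeq z
    have hF : HasFDerivAt (fun z => A m t ((A m s).symm z) - z)
        (fderiv ℝ (fun y' => A m t ((A m s).symm y')) (repr y) - ContinuousLinearMap.id ℝ (EuclideanSpace ℝ (Fin 3)))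
        (repr y) := ((hXd _).hasFDerivAt).sub (hasFDerivAt_id _)
    rw [hl, hF.fderiv]
    simp

end Summit.AnomalousDissipation.AnomalousDissipation.Theorems.SolenoidalFractalHomogenisation.LagrangianCarrierConstruction

end
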